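import Literature.AlgebraicGeometry.HodgeTheory.ChernCharacterLawsSpanReduction
import Summits.HodgeConjecture.HodgeConjecture.Theorems.EightfoldBlochSeedsChernCharacterOnBettiByName
import HarnessLib

/-!
# `stub_spanForOne` of the line `grothendieck_axiomatic` (stmt-HodgeConjecture-19780) from ONE non-vanishing per subvariety

Route `EightfoldBlochSeeds` (decl of record `Theses.EightfoldTwistedSheafSeeds.ChernCharacterOnBetti = Nonempty ChernCharacterBetti`), item
`stmt-HodgeConjecture-19780`, helper (`--supports … --as helper`). HONEST FRAMING: nothing here proves 19780 / 18883 / H2 / HC_AV / HC_CM / HC;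
the registered stub `stub_spanForOne` (skeleton `Cruxes/ChernCharacterOnBetti/Lines/grothendieck_axiomatic.lean`, sha16 `5b9f6051b7bdccf8`) is
REDUCED, not closed; no definition, no named fact.

By `Literature/AlgebraicGeometry/HodgeTheory/ChernCharacterLawsSpanReduction` (assembling `…Coherent`, `…SpanTopDegree`, `…SupportedSheaves`,
Deligne Hodge III 8.2.8 and semipurity — all theorems of the tree): for a lawful non-degenerate datum `ch₀` the span law in every positive
degree follows from

  (NV) for every smooth projective `X` of dimension `n`, every `1 ≤ p`, `1 ≤ d` with `d + p = n`, and every `g : V ⟶ X` from a smooth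
  projective `d`-fold whose generic point maps to a point of dimension `≥ d`, SOME coherent sheaf on `X` supported on `g(V)` has `ch₀_p ≠ 0`

(in print: the leading coefficient of `c_p(𝒪_Z) = (−1)^{p−1}(p−1)! [Z]`, Fulton Example 15.3.5, is non-zero — NOT proved here). Hence:

* `stub_spanForOne_of_forall_exists_supported_ne_zero` — **`stub_spanForOne` VERBATIM from ONE lawful non-degenerate `ch₀` with (NV)**;
* `chernCharacterOnBetti_of_forall_exists_supported_ne_zero` — **the crux `ChernCharacterOnBetti` BY NAME from such a datum**
  (`chernCharacterOnBetti_of_exists_isTopological_span`).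

[cite: Fulton1998, Example 15.3.5, Example 15.2.16 (b) and §19.1 Lemma 19.1.1] [cite: DeligneHodgeIII1974, Cor. 8.2.8] [cite: Grothendieck1958, Thm. 1]
-/

noncomputable section

-- single-problem summit (Problem = Summit): the mandated namespace repeats `HodgeConjecture`.
set_option linter.dupNamespace false

open CategoryTheory CategoryTheory.Limits AlgebraicGeometry
open Literature.AlgebraicGeometry.Motives Literature.AlgebraicGeometry.Modules Literature.AlgebraicGeometry.Morphisms
open Literature.AlgebraicGeometry.HodgeTheory Literature.AlgebraicGeometry.KTheory
open Literature.AlgebraicTopology.SingularHomology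

namespace Summit.HodgeConjecture.HodgeConjecture.Theorems

/-- **`stub_spanForOne` VERBATIM (skeleton `Lines/grothendieck_axiomatic.lean`, sha16 `5b9f6051b7bdccf8`) from ONE lawful non-degenerate datum
with one non-vanishing per subvariety (NV).** [cite: Fulton1998, Example 15.3.5 and Example 15.2.16 (b)] [cite: DeligneHodgeIII1974, Cor. 8.2.8] -/
theorem stub_spanForOne_of_forall_exists_supported_ne_zero (μ : OrientationFamily)
    (hex : ∃ ch₀ : ChernDatum, ∃ h₀ : ch₀.IsTopological, ch₀.NonDegenerate ∧
      ∀ {n : ℕ} {X : SchemeOver ℂ} (hX : IsSmoothProjective n X) {p d : ℕ} (_ : 0 < p) (_ : 0 < d) (_ : d + p = n)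
        (V : SchemeOver ℂ) (_ : IsSmoothProjective d V) (g : V ⟶ X) (η : V.left) (_ : IsGenericPoint η Set.univ)
        (_ : (d : ℕ∞) ≤ Order.height (g.left.base η)),
        ∃ (F : X.left.Modules) (hF : Coh F),
          (∀ W : X.left.Opens, Disjoint (W : Set X.left) (Set.range g.left.base) → IsZero ((Scheme.Modules.pullback W.ι).obj F)) ∧
            ChernDatum.chKZeroCoh ch₀ h₀.ch_shortExact hX p (KZeroCoh.of F hF) ≠ 0) :
    ∃ ch₀ : ChernDatum, ch₀.IsTopological ∧ ch₀.NonDegenerate ∧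
      ∀ {n : ℕ} {X : SchemeOver ℂ}, IsSmoothProjective n X → ∀ {p : ℕ}, 0 < p →
        algebraicClasses X p ≤ Submodule.span ℂ {c | ∃ E : X.left.Modules, IsVectorBundle E ∧ ch₀ X E p = c} := by
  obtain ⟨ch₀, h₀, hnd₀, H⟩ := hex
  exact ⟨ch₀, h₀, hnd₀, fun {n} {X} hX {p} hp ↦
    h₀.algebraicClasses_le_span_of_forall_exists_supported_ne_zero μ hnd₀
      (fun {n} {X} hX {p} {d} hp hd hdp V hV g η hη hle ↦ H hX hp hd hdp V hV g η hη hle) hX hp⟩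

/-- **The crux `ChernCharacterOnBetti` BY NAME from ONE lawful non-degenerate datum with (NV)** (algebraicity and degree `0` are automatic,
`chernCharacterOnBetti_of_exists_isTopological_span`). [cite: Fulton1998, §15.1, Example 15.3.5 and Prop. 19.1.2] [cite: Grothendieck1958, Thm. 1] -/
theorem chernCharacterOnBetti_of_forall_exists_supported_ne_zero (μ : OrientationFamily)
    (hex : ∃ ch₀ : ChernDatum, ∃ h₀ : ch₀.IsTopological, ch₀.NonDegenerate ∧
      ∀ {n : ℕ} {X : SchemeOver ℂ} (hX : IsSmoothProjective n X) {p d : ℕ} (_ : 0 < p) (_ : 0 < d) (_ : d + p = n)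
        (V : SchemeOver ℂ) (_ : IsSmoothProjective d V) (g : V ⟶ X) (η : V.left) (_ : IsGenericPoint η Set.univ)
        (_ : (d : ℕ∞) ≤ Order.height (g.left.base η)),
        ∃ (F : X.left.Modules) (hF : Coh F),
          (∀ W : X.left.Opens, Disjoint (W : Set X.left) (Set.range g.left.base) → IsZero ((Scheme.Modules.pullback W.ι).obj F)) ∧
            ChernDatum.chKZeroCoh ch₀ h₀.ch_shortExact hX p (KZeroCoh.of F hF) ≠ 0) :
    Summit.HodgeConjecture.HodgeConjecture.Theses.EightfoldTwistedSheafSeeds.ChernCharacterOnBetti := by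
  obtain ⟨ch₀, h₀, -, hspan⟩ := stub_spanForOne_of_forall_exists_supported_ne_zero μ hex
  exact chernCharacterOnBetti_of_exists_isTopological_span ⟨ch₀, h₀, fun {n} {X} hX {p} hp ↦ hspan hX hp⟩

end Summit.HodgeConjecture.HodgeConjecture.Theorems

end
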